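import Summits.NavierStokesRegularity.NavierStokesRegularity.Theorems.RellichScarScarRigidityPaintedLadderTimeStep
import Literature.Analysis.FluidPDE.PressurePoisson
import HarnessLib

/-!
# `ScarRigidity`, line `moment-conditioned-rellich` — stub `stub_paintedLadderHigher` (PL≥2), part 2:
# the Poisson equation of the pressure difference and the decay of its source

Crux stmt-NavierStokesRegularity-11717 (route RellichScar), helper file (`--supports`) for the registered stub
`stub_paintedLadderHigher`.  For two classical Navier–Stokes pairs `(V₁, Q₁)`, `(V₂, Q₂)` on the open backward slab the
pressure difference `π = Q₁ − Q₂` solves, on every slice `t < 0`,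

  `Δπ(t) = −g(t)`,  `g(t) = div X(t)`,  `X = (w·∇)V₁ + (V₂·∇)w`,  `w = V₁(t) − V₂(t)`

(`laplacian_pressureDiff_eq`: the two pressure Poisson equations `ΔQᵢ = −div((Vᵢ·∇)Vᵢ)` of the tree and the
bilinearity `(V₁·∇)V₁ − (V₂·∇)V₂ = (w·∇)V₁ + (V₂·∇)w`).  Under the scale-invariant packages and flatness of order `N + 2`
of the pair, the difference and the source decay at the painted orders on the WHOLE slab, with one constant for all
orders `b ≤ M` (`a = √(−t)`, `ρ = ‖y‖ + a`):

* `exists_global_flatness` — `‖Dᵇw(t,y)‖ ≤ W a⁻¹ a^{N+2}/ρ^{N+2+b}` (exterior: flatness; core: the packages);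
* `exists_defectFlux_bound` — `‖DᵇX(t,y)‖ ≤ C a⁻¹ a^{N+2}/ρ^{N+4+b}` (power-weighted Leibniz bounds of the vorticity rung);
* `exists_pressureDiffSource_bound` — `‖Dᵇg(t,y)‖ ≤ C a⁻¹ a^{N+2}/ρ^{N+5+b}` (`div = tr ∘ D` is a fixed linear form of
  the derivative, `norm_iteratedFDeriv_divergence_le`);
* `norm_iteratedFDeriv_pressureDiff_le` — `‖Dᵇπ(t,y)‖ ≤ (L₁ + L₂)/ρ^{2+b}` (the decaying gauges).

These are the inputs of the representation `Dᵇπ = −Γ ⋆ Dᵇg` and of the multipole expansion of the next parts.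
-/

noncomputable section

open Set Filter Function MeasureTheory Metric TopologicalSpace
open scoped Topology ContDiff Laplacian InnerProductSpace RealInnerProductSpace
open Literature.Analysis.FluidPDE

set_option linter.dupNamespace false -- D-0017: `Summit.<S>.<S>.…` repeats the summit name by design

-- nested operator types
set_option maxSynthPendingDepth 4

namespace Summit.NavierStokesRegularity.NavierStokesRegularity.Theorems.RellichScarScarRigidity

/-! ### The divergence as a fixed linear form of the derivative -/

/-- **`div X = Tr ∘ DX`** for the (continuous, fixed) trace form `Tr` on `ℝ³ →L[ℝ] ℝ³`. [folklore] -/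
theorem exists_traceForm :
    ∃ Tr : (EuclideanSpace ℝ (Fin 3) →L[ℝ] EuclideanSpace ℝ (Fin 3)) →L[ℝ] ℝ,
      ∀ X : EuclideanSpace ℝ (Fin 3) → EuclideanSpace ℝ (Fin 3), VectorCalculus.divergence X = Tr ∘ fderiv ℝ X := by
  refine ⟨LinearMap.toContinuousLinearMap
      ((LinearMap.trace ℝ (EuclideanSpace ℝ (Fin 3))).comp (ContinuousLinearMap.coeLM ℝ)), fun X => ?_⟩
  funext y
  rfl

/-- **`‖Dᵇ(div X)(y)‖ ≤ c_div ‖Dᵇ⁺¹X(y)‖`** for smooth fields, with an absolute constant `c_div ≥ 0` (the norm of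
the trace form). [folklore] -/
theorem exists_norm_iteratedFDeriv_divergence_le :
    ∃ c : ℝ, 0 ≤ c ∧ ∀ (X : EuclideanSpace ℝ (Fin 3) → EuclideanSpace ℝ (Fin 3)), ContDiff ℝ ∞ X →
      ∀ (b : ℕ) (y : EuclideanSpace ℝ (Fin 3)),
        ‖iteratedFDeriv ℝ b (VectorCalculus.divergence X) y‖ ≤ c * ‖iteratedFDeriv ℝ (b + 1) X y‖ := by
  obtain ⟨Tr, hTr⟩ := exists_traceForm
  refine ⟨‖Tr‖, norm_nonneg _, fun X hX b y => ?_⟩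
  rw [hTr X]
  have hDX : ContDiff ℝ ∞ (fderiv ℝ X) := hX.fderiv_right (m := ∞) le_rfl
  calc ‖iteratedFDeriv ℝ b (Tr ∘ fderiv ℝ X) y‖ ≤ ‖Tr‖ * ‖iteratedFDeriv ℝ b (fderiv ℝ X) y‖ :=
        Tr.norm_iteratedFDeriv_comp_left hDX.contDiffAt (by exact_mod_cast le_top)
    _ = ‖Tr‖ * ‖iteratedFDeriv ℝ (b + 1) X y‖ := by rw [norm_iteratedFDeriv_fderiv]

/-- The divergence of a smooth field is smooth. [folklore] -/
theorem contDiff_divergence_of_smooth {X : EuclideanSpace ℝ (Fin 3) → EuclideanSpace ℝ (Fin 3)}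
    (hX : ContDiff ℝ ∞ X) : ContDiff ℝ ∞ (VectorCalculus.divergence X) := by
  obtain ⟨Tr, hTr⟩ := exists_traceForm
  rw [hTr X]
  exact Tr.contDiff.comp (hX.fderiv_right (m := ∞) le_rfl)

/-! ### The twins: global flatness of order `N + 2` and the defect flux -/

section Twins

variable {V₁ V₂ : ℝ → EuclideanSpace ℝ (Fin 3) → EuclideanSpace ℝ (Fin 3)}
  {Q₁ Q₂ : ℝ → EuclideanSpace ℝ (Fin 3) → ℝ}

/-- **Global flatness of order `N + 2`.**  Under the scale-invariant packages, flatness of order `N + 2` on the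
parabolic exterior extends to the whole slab in the form
`‖Dᵇ(V₁ − V₂)(t,y)‖ ≤ W (√(−t))⁻¹ (√(−t))^{N+2}/(‖y‖+√(−t))^{N+2+b}` (`b ≤ M`, one constant): on the exterior
`‖y‖+√(−t) ≤ 2‖y‖`; in the core `‖DᵇVᵢ‖ ≤ Lᵢ/ρ^{1+b} = Lᵢρ^{N+1}/ρ^{N+2+b}` and `ρ ≤ 2√(−t)`. [folklore] -/
theorem exists_global_flatness (hV₁ : IsSmoothSpaceTimeOn (Iio (0 : ℝ)) V₁) (hV₂ : IsSmoothSpaceTimeOn (Iio (0 : ℝ)) V₂)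
    (hB₁ : ScaleInvariantBounds V₁ Q₁) (hB₂ : ScaleInvariantBounds V₂ Q₂) (N : ℕ) (hF : FarDecay (N + 2) V₁ V₂)
    (M : ℕ) :
    ∃ W : ℝ, 0 ≤ W ∧ ∀ b ≤ M, ∀ t < 0, ∀ y : EuclideanSpace ℝ (Fin 3),
      ‖iteratedFDeriv ℝ b (fun z => V₁ t z - V₂ t z) y‖ ≤
        W * (Real.sqrt (-t))⁻¹ * Real.sqrt (-t) ^ (N + 2) / (‖y‖ + Real.sqrt (-t)) ^ (N + 2 + b) := by
  obtain ⟨L₁, hL₁0, hL₁⟩ := scaleInvariantBounds_uniform hB₁ M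
  obtain ⟨L₂, hL₂0, hL₂⟩ := scaleInvariantBounds_uniform hB₂ M
  obtain ⟨K, hK0, hK⟩ := farDecay_uniform (N + 2) hF M
  refine ⟨2 ^ (N + 2 + M) * K + 2 ^ (N + 1) * (L₁ + L₂), by positivity, fun b hb t ht y => ?_⟩
  have hσ : 0 < Real.sqrt (-t) := Real.sqrt_pos.2 (by linarith)
  have hnt : 0 < -t := by linarith
  set a : ℝ := Real.sqrt (-t) with ha_def
  set ρ : ℝ := ‖y‖ + a with hρ
  have hρ0 : 0 < ρ := by positivity
  have hρb : 0 < ρ ^ (N + 2 + b) := pow_pos hρ0 _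
  have hAa : 0 ≤ a⁻¹ * a ^ (N + 2) := by positivity
  rcases le_or_gt a ‖y‖ with hy | hy
  · -- exterior
    have hypos : 0 < ‖y‖ := hσ.trans_le hy
    have h1 := hK b hb t ht y hy
    have hρy : ρ ≤ 2 * ‖y‖ := by rw [hρ]; linarith
    have hpow : ρ ^ (N + 2 + b) ≤ 2 ^ (N + 2 + M) * ‖y‖ ^ (N + 2 + b) :=
      calc ρ ^ (N + 2 + b) ≤ (2 * ‖y‖) ^ (N + 2 + b) := pow_le_pow_left₀ hρ0.le hρy _
        _ = 2 ^ (N + 2 + b) * ‖y‖ ^ (N + 2 + b) := mul_pow _ _ _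
        _ ≤ 2 ^ (N + 2 + M) * ‖y‖ ^ (N + 2 + b) :=
            mul_le_mul_of_nonneg_right (pow_le_pow_right₀ one_le_two (by omega)) (pow_nonneg hypos.le _)
    calc ‖iteratedFDeriv ℝ b (fun z => V₁ t z - V₂ t z) y‖ ≤ K * a⁻¹ * a ^ (N + 2) / ‖y‖ ^ (N + 2 + b) := h1
      _ ≤ 2 ^ (N + 2 + M) * K * a⁻¹ * a ^ (N + 2) / ρ ^ (N + 2 + b) := by
          rw [div_le_div_iff₀ (pow_pos hypos _) hρb]
          calc K * a⁻¹ * a ^ (N + 2) * ρ ^ (N + 2 + b)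
              ≤ K * a⁻¹ * a ^ (N + 2) * (2 ^ (N + 2 + M) * ‖y‖ ^ (N + 2 + b)) :=
                mul_le_mul_of_nonneg_left hpow (by positivity)
            _ = 2 ^ (N + 2 + M) * K * a⁻¹ * a ^ (N + 2) * ‖y‖ ^ (N + 2 + b) := by ring
      _ ≤ (2 ^ (N + 2 + M) * K + 2 ^ (N + 1) * (L₁ + L₂)) * a⁻¹ * a ^ (N + 2) / ρ ^ (N + 2 + b) := by
          refine div_le_div_of_nonneg_right (mul_le_mul_of_nonneg_right (mul_le_mul_of_nonneg_right ?_
            (inv_nonneg.2 hσ.le)) (pow_nonneg hσ.le _)) hρb.le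
          have : 0 ≤ 2 ^ (N + 1) * (L₁ + L₂) := by positivity
          linarith
  · -- core
    have h1 := (hL₁ b hb t ht y).1
    have h2 := (hL₂ b hb t ht y).1
    have hρa : ρ ≤ 2 * a := by rw [hρ]; linarith
    have hρN : ρ ^ (N + 1) ≤ 2 ^ (N + 1) * (a⁻¹ * a ^ (N + 2)) := by
      calc ρ ^ (N + 1) ≤ (2 * a) ^ (N + 1) := pow_le_pow_left₀ hρ0.le hρa _
        _ = 2 ^ (N + 1) * (a⁻¹ * a ^ (N + 2)) := by
            rw [mul_pow, pow_succ a (N + 1)]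
            field_simp
    rw [iteratedFDeriv_sub_slice hV₁ hV₂ b ht y]
    calc ‖iteratedFDeriv ℝ b (V₁ t) y - iteratedFDeriv ℝ b (V₂ t) y‖
        ≤ ‖iteratedFDeriv ℝ b (V₁ t) y‖ + ‖iteratedFDeriv ℝ b (V₂ t) y‖ := norm_sub_le _ _
      _ ≤ L₁ / ρ ^ (1 + b) + L₂ / ρ ^ (1 + b) := add_le_add h1 h2
      _ = (L₁ + L₂) * ρ ^ (N + 1) / ρ ^ (N + 2 + b) := by
          rw [← add_div, div_eq_div_iff (pow_pos hρ0 _).ne' hρb.ne', show N + 2 + b = (N + 1) + (1 + b) by ring,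
            pow_add]
          ring
      _ ≤ (L₁ + L₂) * (2 ^ (N + 1) * (a⁻¹ * a ^ (N + 2))) / ρ ^ (N + 2 + b) :=
          div_le_div_of_nonneg_right (mul_le_mul_of_nonneg_left hρN (add_nonneg hL₁0 hL₂0)) hρb.le
      _ ≤ (2 ^ (N + 2 + M) * K + 2 ^ (N + 1) * (L₁ + L₂)) * a⁻¹ * a ^ (N + 2) / ρ ^ (N + 2 + b) := by
          refine div_le_div_of_nonneg_right ?_ hρb.le
          have : 0 ≤ 2 ^ (N + 2 + M) * K * (a⁻¹ * a ^ (N + 2)) := by positivity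
          nlinarith

/-- **All derivatives of the defect flux `X = (w·∇)V₁ + (V₂·∇)w` on the whole slab**:
`‖DⁿX(t,y)‖ ≤ C (√(−t))⁻¹ (√(−t))^{N+2}/(‖y‖+√(−t))^{N+4+n}` under the packages and flatness of order `N + 2`
(power-weighted Leibniz bounds `norm_iteratedFDeriv_convect_le_of_pow_bounds`). [folklore] -/
theorem exists_defectFlux_bound (hcl₁ : IsClassicalNSSolutionOn (Iio (0 : ℝ)) 1 0 V₁ Q₁)
    (hcl₂ : IsClassicalNSSolutionOn (Iio (0 : ℝ)) 1 0 V₂ Q₂) (hB₁ : ScaleInvariantBounds V₁ Q₁)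
    (hB₂ : ScaleInvariantBounds V₂ Q₂) (N : ℕ) (hF : FarDecay (N + 2) V₁ V₂) (n : ℕ) :
    ∃ C : ℝ, 0 ≤ C ∧ ∀ t < 0, ∀ y : EuclideanSpace ℝ (Fin 3),
      ‖iteratedFDeriv ℝ n (fun y => convect (fun z => V₁ t z - V₂ t z) (V₁ t) y +
          convect (V₂ t) (fun z => V₁ t z - V₂ t z) y) y‖ ≤
        C * (Real.sqrt (-t))⁻¹ * Real.sqrt (-t) ^ (N + 2) / (‖y‖ + Real.sqrt (-t)) ^ (N + 4 + n) := by
  obtain ⟨W, hW0, hW⟩ := exists_global_flatness hcl₁.smooth_velocity hcl₂.smooth_velocity hB₁ hB₂ N hF (n + 1)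
  obtain ⟨L, hL0, hL⟩ := exists_twin_velocity_bounds hB₁ hB₂ (n + 1)
  refine ⟨2 ^ (n + 1) * W * L, by positivity, fun t ht y => ?_⟩
  have hσ : 0 < Real.sqrt (-t) := Real.sqrt_pos.2 (by linarith)
  have hρ : 0 < ‖y‖ + Real.sqrt (-t) := by positivity
  have hw : ContDiff ℝ ∞ (fun z => V₁ t z - V₂ t z) := (hcl₁.contDiff_velocity ht).sub (hcl₂.contDiff_velocity ht)
  have hV₁ : ContDiff ℝ ∞ (V₁ t) := hcl₁.contDiff_velocity ht
  have hV₂ : ContDiff ℝ ∞ (V₂ t) := hcl₂.contDiff_velocity ht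
  set A : ℝ := W * (Real.sqrt (-t))⁻¹ * Real.sqrt (-t) ^ (N + 2) with hA
  have hA0 : 0 ≤ A := by positivity
  have hwb : ∀ b ≤ n + 1, ‖iteratedFDeriv ℝ b (fun z => V₁ t z - V₂ t z) y‖ ≤ A / (‖y‖ + Real.sqrt (-t)) ^ (N + 2 + b) :=
    fun b hb => hW b hb t ht y
  have b1 := norm_iteratedFDeriv_convect_le_of_pow_bounds hw hV₁ (n := n) (p := N + 2) (q := 1) hρ hL0
    (fun b hb => hwb b (by omega)) (fun b hb => (hL b hb t ht y).1)
  have b2 := norm_iteratedFDeriv_convect_le_of_pow_bounds hV₂ hw (n := n) (p := 1) (q := N + 2) hρ hA0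
    (fun b hb => (hL b (by omega) t ht y).2) (fun b hb => hwb b hb)
  have hn : ((n : ℕ∞) : WithTop ℕ∞) ≤ ∞ := by exact_mod_cast le_top
  rw [fun_iteratedFDeriv_add_apply ((contDiff_convect hw hV₁).of_le hn).contDiffAt
    ((contDiff_convect hV₂ hw).of_le hn).contDiffAt]
  rw [show N + 2 + 1 + 1 + n = N + 4 + n by ring] at b1
  rw [show 1 + (N + 2) + 1 + n = N + 4 + n by ring] at b2
  calc _ ≤ ‖iteratedFDeriv ℝ n (convect (fun z => V₁ t z - V₂ t z) (V₁ t)) y‖ +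
        ‖iteratedFDeriv ℝ n (convect (V₂ t) (fun z => V₁ t z - V₂ t z)) y‖ := norm_add_le _ _
    _ ≤ 2 ^ n * A * L / (‖y‖ + Real.sqrt (-t)) ^ (N + 4 + n) + 2 ^ n * L * A / (‖y‖ + Real.sqrt (-t)) ^ (N + 4 + n) :=
        add_le_add b1 b2
    _ = 2 ^ (n + 1) * W * L * (Real.sqrt (-t))⁻¹ * Real.sqrt (-t) ^ (N + 2) / (‖y‖ + Real.sqrt (-t)) ^ (N + 4 + n) := by
        rw [hA]; ring

/-- The defect flux of the twins is smooth on every slice. [folklore] -/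
theorem contDiff_defectFlux_slice (hcl₁ : IsClassicalNSSolutionOn (Iio (0 : ℝ)) 1 0 V₁ Q₁)
    (hcl₂ : IsClassicalNSSolutionOn (Iio (0 : ℝ)) 1 0 V₂ Q₂) {t : ℝ} (ht : t < 0) :
    ContDiff ℝ ∞ fun y => convect (fun z => V₁ t z - V₂ t z) (V₁ t) y + convect (V₂ t) (fun z => V₁ t z - V₂ t z) y :=
  (contDiff_convect ((hcl₁.contDiff_velocity ht).sub (hcl₂.contDiff_velocity ht)) (hcl₁.contDiff_velocity ht)).add
    (contDiff_convect (hcl₂.contDiff_velocity ht) ((hcl₁.contDiff_velocity ht).sub (hcl₂.contDiff_velocity ht)))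

/-- **All derivatives of the source `g = div X` of the pressure Poisson equation of the difference, on the whole
slab**: `‖Dⁿg(t,y)‖ ≤ C (√(−t))⁻¹ (√(−t))^{N+2}/(‖y‖+√(−t))^{N+5+n}`. [folklore] -/
theorem exists_pressureDiffSource_bound (hcl₁ : IsClassicalNSSolutionOn (Iio (0 : ℝ)) 1 0 V₁ Q₁)
    (hcl₂ : IsClassicalNSSolutionOn (Iio (0 : ℝ)) 1 0 V₂ Q₂) (hB₁ : ScaleInvariantBounds V₁ Q₁)
    (hB₂ : ScaleInvariantBounds V₂ Q₂) (N : ℕ) (hF : FarDecay (N + 2) V₁ V₂) (n : ℕ) :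
    ∃ C : ℝ, 0 ≤ C ∧ ∀ t < 0, ∀ y : EuclideanSpace ℝ (Fin 3),
      ‖iteratedFDeriv ℝ n (VectorCalculus.divergence fun y => convect (fun z => V₁ t z - V₂ t z) (V₁ t) y +
          convect (V₂ t) (fun z => V₁ t z - V₂ t z) y) y‖ ≤
        C * (Real.sqrt (-t))⁻¹ * Real.sqrt (-t) ^ (N + 2) / (‖y‖ + Real.sqrt (-t)) ^ (N + 5 + n) := by
  obtain ⟨c, hc0, hc⟩ := exists_norm_iteratedFDeriv_divergence_le
  obtain ⟨C, hC0, hC⟩ := exists_defectFlux_bound hcl₁ hcl₂ hB₁ hB₂ N hF (n + 1)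
  refine ⟨c * C, by positivity, fun t ht y => ?_⟩
  have h1 := hc _ (contDiff_defectFlux_slice hcl₁ hcl₂ ht) n y
  have h2 := hC t ht y
  rw [show N + 4 + (n + 1) = N + 5 + n by ring] at h2
  calc _ ≤ _ := h1
    _ ≤ c * (C * (Real.sqrt (-t))⁻¹ * Real.sqrt (-t) ^ (N + 2) / (‖y‖ + Real.sqrt (-t)) ^ (N + 5 + n)) :=
        mul_le_mul_of_nonneg_left h2 hc0
    _ = _ := by ring

/-! ### The Poisson equation of the pressure difference -/

/-- **`(V₁·∇)V₁ − (V₂·∇)V₂ = (w·∇)V₁ + (V₂·∇)w`** on a slice (bilinearity of the convective derivative). [folklore] -/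
theorem convect_self_sub_convect_self_slice (hcl₁ : IsClassicalNSSolutionOn (Iio (0 : ℝ)) 1 0 V₁ Q₁)
    (hcl₂ : IsClassicalNSSolutionOn (Iio (0 : ℝ)) 1 0 V₂ Q₂) {t : ℝ} (ht : t < 0) :
    (fun y => convect (V₁ t) (V₁ t) y - convect (V₂ t) (V₂ t) y) = fun y =>
      convect (fun z => V₁ t z - V₂ t z) (V₁ t) y + convect (V₂ t) (fun z => V₁ t z - V₂ t z) y := by
  have hV₁ : ContDiff ℝ ∞ (V₁ t) := hcl₁.contDiff_velocity ht
  have hV₂ : ContDiff ℝ ∞ (V₂ t) := hcl₂.contDiff_velocity ht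
  funext y
  simp only [convect_apply]
  rw [fderiv_fun_sub (hV₁.differentiable (by simp) y) (hV₂.differentiable (by simp) y)]
  simp only [_root_.sub_apply, map_sub]
  abel

/-- **The Poisson equation of the pressure difference**: for `t < 0` and every `y`,
`Δ(Q₁(t) − Q₂(t))(y) = −div((w·∇)V₁ + (V₂·∇)w)(y)`, `w = V₁(t) − V₂(t)` (the two pressure Poisson equations
`ΔQᵢ = −div((Vᵢ·∇)Vᵢ)` of the tree, `laplacian_pressure_eq_of_isClassicalNSSolutionOn`, and bilinearity). [folklore] -/
theorem laplacian_pressureDiff_eq (hcl₁ : IsClassicalNSSolutionOn (Iio (0 : ℝ)) 1 0 V₁ Q₁)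
    (hcl₂ : IsClassicalNSSolutionOn (Iio (0 : ℝ)) 1 0 V₂ Q₂) {t : ℝ} (ht : t < 0) (y : EuclideanSpace ℝ (Fin 3)) :
    Δ (fun z => Q₁ t z - Q₂ t z) y =
      -VectorCalculus.divergence (fun y => convect (fun z => V₁ t z - V₂ t z) (V₁ t) y +
          convect (V₂ t) (fun z => V₁ t z - V₂ t z) y) y := by
  have ht' : t ∈ interior (Iio (0 : ℝ)) := by rw [interior_Iio]; exact ht
  have h₁ := laplacian_pressure_eq_of_isClassicalNSSolutionOn hcl₁ ht' y
  have h₂ := laplacian_pressure_eq_of_isClassicalNSSolutionOn hcl₂ ht' y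
  have hQ₁ : ContDiff ℝ ∞ (Q₁ t) := hcl₁.contDiff_pressure ht
  have hQ₂ : ContDiff ℝ ∞ (Q₂ t) := hcl₂.contDiff_pressure ht
  have hV₁ : ContDiff ℝ ∞ (V₁ t) := hcl₁.contDiff_velocity ht
  have hV₂ : ContDiff ℝ ∞ (V₂ t) := hcl₂.contDiff_velocity ht
  have e0 : VectorCalculus.divergence ((0 : ℝ → EuclideanSpace ℝ (Fin 3) → EuclideanSpace ℝ (Fin 3)) t) y = 0 := by
    simp [VectorCalculus.divergence]
  rw [e0, add_zero] at h₁ h₂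
  have hΔ : Δ (fun z => Q₁ t z - Q₂ t z) y = Δ (Q₁ t) y - Δ (Q₂ t) y :=
    ContDiffAt.laplacian_sub (hQ₁.of_le (by norm_cast)).contDiffAt (hQ₂.of_le (by norm_cast)).contDiffAt
  rw [hΔ, h₁, h₂, ← convect_self_sub_convect_self_slice hcl₁ hcl₂ ht,
    divergence_sub_apply ((contDiff_convect hV₁ hV₁).differentiable (by simp) y)
      ((contDiff_convect hV₂ hV₂).differentiable (by simp) y)]
  ring

/-- **The pressure difference decays with all derivatives**: `‖Dᵇ(Q₁(t) − Q₂(t))(y)‖ ≤ (L₁+L₂)/(‖y‖+√(−t))^{2+b}` for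
`b ≤ M` (the decaying gauges of the two packages, one constant). [folklore] -/
theorem exists_pressureDiff_bound (hcl₁ : IsClassicalNSSolutionOn (Iio (0 : ℝ)) 1 0 V₁ Q₁)
    (hcl₂ : IsClassicalNSSolutionOn (Iio (0 : ℝ)) 1 0 V₂ Q₂) (hB₁ : ScaleInvariantBounds V₁ Q₁)
    (hB₂ : ScaleInvariantBounds V₂ Q₂) (M : ℕ) :
    ∃ L : ℝ, 0 ≤ L ∧ ∀ b ≤ M, ∀ t < 0, ∀ y : EuclideanSpace ℝ (Fin 3),
      ‖iteratedFDeriv ℝ b (fun z => Q₁ t z - Q₂ t z) y‖ ≤ L / (‖y‖ + Real.sqrt (-t)) ^ (2 + b) := by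
  obtain ⟨L₁, hL₁0, hL₁⟩ := scaleInvariantBounds_uniform hB₁ M
  obtain ⟨L₂, hL₂0, hL₂⟩ := scaleInvariantBounds_uniform hB₂ M
  refine ⟨L₁ + L₂, add_nonneg hL₁0 hL₂0, fun b hb t ht y => ?_⟩
  have hQ₁ : ContDiff ℝ b (Q₁ t) := (hcl₁.contDiff_pressure ht).of_le (by exact_mod_cast le_top)
  have hQ₂ : ContDiff ℝ b (Q₂ t) := (hcl₂.contDiff_pressure ht).of_le (by exact_mod_cast le_top)
  rw [fun_iteratedFDeriv_sub_apply hQ₁.contDiffAt hQ₂.contDiffAt, add_div]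
  exact (norm_sub_le _ _).trans (add_le_add (hL₁ b hb t ht y).2.1 (hL₂ b hb t ht y).2.1)

end Twins

/-! ### Registered sub-goal -/

/-- **Registered helper stub `stub_paintedLadderDefectTools`** of `stub_paintedLadderHigher` (crux
stmt-NavierStokesRegularity-11717, line `moment-conditioned-rellich`): the Poisson equation of the pressure difference
`Δ(Q₁ − Q₂) = −div((w·∇)V₁ + (V₂·∇)w)`, the decay of `Dᵇ(Q₁ − Q₂)` in the decaying gauges, and — under flatness of
order `N + 2` — global flatness of the difference and the decay of all derivatives of the source. [folklore] -/
theorem stub_paintedLadderDefectTools :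
    ∀ (V₁ V₂ : ℝ → EuclideanSpace ℝ (Fin 3) → EuclideanSpace ℝ (Fin 3)) (Q₁ Q₂ : ℝ → EuclideanSpace ℝ (Fin 3) → ℝ), IsClassicalNSSolutionOn (Iio (0 : ℝ)) 1 0 V₁ Q₁ → IsClassicalNSSolutionOn (Iio (0 : ℝ)) 1 0 V₂ Q₂ → (∀ t < 0, ∀ y : EuclideanSpace ℝ (Fin 3), Laplacian.laplacian (fun z => Q₁ t z - Q₂ t z) y = -VectorCalculus.divergence (fun y => convect (fun z => V₁ t z - V₂ t z) (V₁ t) y + convect (V₂ t) (fun z => V₁ t z - V₂ t z) y) y) ∧ (ScaleInvariantBounds V₁ Q₁ → ScaleInvariantBounds V₂ Q₂ → (∀ M : ℕ, ∃ L : ℝ, 0 ≤ L ∧ ∀ b ≤ M, ∀ t < 0, ∀ y : EuclideanSpace ℝ (Fin 3), ‖iteratedFDeriv ℝ b (fun z => Q₁ t z - Q₂ t z) y‖ ≤ L / (‖y‖ + Real.sqrt (-t)) ^ (2 + b)) ∧ ∀ N : ℕ, FarDecay (N + 2) V₁ V₂ → (∀ M : ℕ, ∃ W : ℝ, 0 ≤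 W ∧ ∀ b ≤ M, ∀ t < 0, ∀ y : EuclideanSpace ℝ (Fin 3), ‖iteratedFDeriv ℝ b (fun z => V₁ t z - V₂ t z) y‖ ≤ W * (Real.sqrt (-t))⁻¹ * Real.sqrt (-t) ^ (N + 2) / (‖y‖ + Real.sqrt (-t)) ^ (N + 2 + b)) ∧ (∀ n : ℕ, ∃ C : ℝ, 0 ≤ C ∧ ∀ t < 0, ∀ y : EuclideanSpace ℝ (Fin 3), ‖iteratedFDeriv ℝ n (VectorCalculus.divergence fun y => convect (fun z => V₁ t z - V₂ t z) (V₁ t) y + convect (V₂ t) (fun z => V₁ t z - V₂ t z) y) y‖ ≤ C * (Real.sqrt (-t))⁻¹ * Real.sqrt (-t) ^ (N + 2) / (‖y‖ + Real.sqrt (-t)) ^ (N + 5 + n))) :=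
  fun _V₁ _V₂ _Q₁ _Q₂ hcl₁ hcl₂ =>
    ⟨fun _t ht y => laplacian_pressureDiff_eq hcl₁ hcl₂ ht y,
      fun hB₁ hB₂ => ⟨fun M => exists_pressureDiff_bound hcl₁ hcl₂ hB₁ hB₂ M,
        fun N hF => ⟨fun M => exists_global_flatness hcl₁.smooth_velocity hcl₂.smooth_velocity hB₁ hB₂ N hF M,
          fun n => exists_pressureDiffSource_bound hcl₁ hcl₂ hB₁ hB₂ N hF n⟩⟩⟩

end Summit.NavierStokesRegularity.NavierStokesRegularity.Theorems.RellichScarScarRigidity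

end
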